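import Summits.KontsevichZagierPeriods.KontsevichZagierPeriods.Theorems.BetaCancellation.Negative.KernelForm
import Literature.NumberTheory.Transcendental.KZSubcalculusInvariants

/-!
# `BetaCancellation` (stmt-KontsevichZagierPeriods-13633) — PROVED for all positive integer exponents

Companion of `Negative/KernelForm.lean` (which proves the instance `a = b = 1`). For
`(a, b) = (A+1, B+1)`, `A, B ∈ ℕ`, the Beta kernel `t^A(1−t)^B` is a `ℚ`-polynomial with polynomial
primitive `P = antideriv (X^A (1−X)^B)`, `P(0) = 0`, `P(1) = B(A+1,B+1) = A!B!/(A+B+1)! = 1/N`,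
`N = (A+B+1)!/(A!B!) ∈ ℕ` (`aeval_one_antideriv_kerPoly_eq_inv`: FTC + the Beta integral +
`Real.Gamma_nat_eq_factorial`). A pinned `q` is then, modulo one coordinate rotation and a null
boundary, the band `[[0,1] × σ, P'(t) f]` (`equivalent_polySlab_of_isPinned`), which is ONE
Newton–Leibniz move away from `[σ, f/N]` (`polySlab_sub_scaledBase_mem`); and
`[r] − N • [σ, f/N] ∈ relations` by integrand additivity ALONE
(`KZ.IntegralRep.of_constMul_nat_sub_nsmul_mem_relations`) — the factor `1/N` rides inside the
integrand, so NO division by `N` is needed. Hence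
`kernelCancellation_betaKernel_natCast_succ (A B : ℕ) : KernelCancellation (betaKernel (A+1) (B+1))`
and `betaCancellation_of_int` (the crux's literal shape). THE OPEN CONTENT OF THE CRUX IS EXACTLY
THE NON-INTEGER REGIME, where the kernel has no semialgebraic primitive and `1/B(a,b)` is not
expected to be an effective period (e.g. `B(1/2,1/2) = π`, `Negative/PiLink.lean`).
cdisprove (refuter) file; sorry-free, axioms ⊆ {propext, Classical.choice, Quot.sound}.
[Kontsevich–Zagier 2001, §1.2 rules (1)–(3)]
-/

noncomputable section

set_option linter.dupNamespace false

namespace Summit.KontsevichZagierPeriods.KontsevichZagierPeriods.BetaCancellationNegative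

open MeasureTheory Set
open Literature.NumberTheory.Transcendental
open Literature.NumberTheory.Transcendental.KZ
open Literature.ModelTheory.ExponentialFields (IsSemialgebraic isSemialgebraic_univ)
open MvPolynomial (aeval X C)
open Summit.KontsevichZagierPeriods.KontsevichZagierPeriods.Theses.TerasomaMultiplication
  (BetaCancellation)
open Literature.NumberTheory.Transcendental.KZreg (unitIoo isSemialgebraic_unitIoo volume_unitIoo)

/-! ## All positive INTEGER exponents `(a, b) = (A+1, B+1)`

For integer exponents the kernel `t^A (1−t)^B` is a `ℚ`-polynomial with a polynomial primitive
`P`, `P(0) = 0`, `P(1) = B(A+1,B+1) = A!B!/(A+B+1)! = 1/N` with `N = (A+B+1)!/(A!B!) ∈ ℕ`. So a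
pinned `q` is, modulo one coordinate rotation and a null boundary, the band
`[[0,1] × σ, P'(t) f]`, which is ONE Newton–Leibniz move away from `[σ, f/N]`; and
`N • [σ, f/N] ∼ [σ, f] = [r]` is integrand additivity (`KZ.IntegralRep.of_constMul_nat_sub_nsmul_mem_relations`).
Hence `q ∼ q' ⇒ [σ,f/N] ∼ [σ',f'/N] ⇒ r ∼ r'` — NO division by `N` is needed because the factor
`1/N` travels inside the integrand. This is exactly what fails for non-integer exponents: the
primitive of `t^{a-1}(1-t)^{b-1}` is not semialgebraic and `B(a,b)` is (expected) transcendental. -/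

section IntegerExponents

open Polynomial

/-- A polynomial antiderivative with zero constant term. [folklore] -/
def antideriv (p : ℚ[X]) : ℚ[X] := p.sum fun i c => Polynomial.C (c / (i + 1)) * Polynomial.X ^ (i + 1)

/-- `(antideriv p)' = p`. [folklore] -/
theorem derivative_antideriv (p : ℚ[X]) : derivative (antideriv p) = p := by
  rw [antideriv, Polynomial.sum_def, derivative_sum]
  conv_rhs => rw [← p.sum_C_mul_X_pow_eq, Polynomial.sum_def]
  refine Finset.sum_congr rfl fun i _ => ?_
  rw [derivative_C_mul_X_pow, Nat.add_sub_cancel]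
  congr 2
  push_cast
  field_simp

/-- `antideriv p` has no constant term. [folklore] -/
theorem antideriv_coeff_zero (p : ℚ[X]) : (antideriv p).coeff 0 = 0 := by
  rw [antideriv, Polynomial.sum_def, finsetSum_coeff]
  refine Finset.sum_eq_zero fun i _ => ?_
  simp [coeff_X_pow]

/-- `(antideriv p)(0) = 0` over `ℝ`. [folklore] -/
theorem aeval_zero_antideriv (p : ℚ[X]) : (aeval (0:ℝ) (antideriv p) : ℝ) = 0 := by
  simp [Polynomial.aeval_def, Polynomial.eval₂_at_zero, antideriv_coeff_zero]

/-- The integer-exponent kernel `X^A (1 − X)^B ∈ ℚ[X]`. [folklore] -/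
def kerPoly (A B : ℕ) : ℚ[X] := Polynomial.X ^ A * (1 - Polynomial.X) ^ B

/-- Evaluating `kerPoly`. [folklore] -/
@[simp] theorem aeval_kerPoly (A B : ℕ) (t : ℝ) : (aeval t (kerPoly A B) : ℝ) = t ^ A * (1 - t) ^ B := by
  simp [kerPoly]

/-- The Beta kernel at integer exponents is the polynomial kernel (everywhere on `ℝ`). [folklore] -/
theorem betaKernel_natCast_succ (A B : ℕ) :
    betaKernel ((A:ℚ) + 1) ((B:ℚ) + 1) = fun t => (aeval t (kerPoly A B) : ℝ) := by
  funext t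
  simp only [betaKernel, aeval_kerPoly]
  push_cast
  simp only [add_sub_cancel_right, Real.rpow_natCast]

/-- `B(A+1, B+1) = A! B! / (A+B+1)!`. [folklore] -/
theorem beta_natCast_succ (A B : ℕ) :
    ProbabilityTheory.beta ((A:ℝ) + 1) ((B:ℝ) + 1) =
      (A.factorial * B.factorial : ℝ) / (A + B + 1).factorial := by
  rw [ProbabilityTheory.beta]
  have h1 : Real.Gamma ((A:ℝ) + 1) = A.factorial := Real.Gamma_nat_eq_factorial A
  have h2 : Real.Gamma ((B:ℝ) + 1) = B.factorial := Real.Gamma_nat_eq_factorial B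
  have h3 : Real.Gamma ((A:ℝ) + 1 + ((B:ℝ) + 1)) = (A + B + 1).factorial := by
    rw [show (A:ℝ) + 1 + ((B:ℝ) + 1) = ((A + B + 1 : ℕ) : ℝ) + 1 by push_cast; ring]
    exact Real.Gamma_nat_eq_factorial _
  rw [h1, h2, h3]

/-- **`P(1) = A!B!/(A+B+1)!`** for the primitive `P = antideriv (kerPoly A B)` (FTC + the Beta
integral). [folklore] -/
theorem aeval_one_antideriv_kerPoly (A B : ℕ) :
    (aeval (1:ℝ) (antideriv (kerPoly A B)) : ℝ) = (A.factorial * B.factorial : ℝ) / (A + B + 1).factorial := by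
  have hFTC : ∫ t in (0:ℝ)..1, (aeval t (kerPoly A B) : ℝ) =
      aeval (1:ℝ) (antideriv (kerPoly A B)) - aeval (0:ℝ) (antideriv (kerPoly A B)) :=
    intervalIntegral.integral_eq_sub_of_hasDerivAt (f := fun x : ℝ => (aeval x (antideriv (kerPoly A B)) : ℝ))
      (fun t _ => by
        have h := Polynomial.hasDerivAt_aeval (antideriv (kerPoly A B)) t
        rwa [derivative_antideriv] at h)
      ((Polynomial.continuous_aeval _).intervalIntegrable _ _)
  have hI : ∫ t in (0:ℝ)..1, (aeval t (kerPoly A B) : ℝ) = ProbabilityTheory.beta ((A:ℝ) + 1) ((B:ℝ) + 1) := by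
    rw [intervalIntegral.integral_of_le zero_le_one, integral_Ioc_eq_integral_Ioo]
    have hb := (integrableOn_betaKernel_and_integral_eq (a := (A:ℚ) + 1) (b := (B:ℚ) + 1)
      (by positivity) (by positivity)).2
    push_cast at hb
    rw [← hb, betaKernel_natCast_succ]
  rw [aeval_zero_antideriv, sub_zero] at hFTC
  rw [← hFTC, hI, beta_natCast_succ]

/-- The integer `N = (A+B+1)!/(A!B!)`. [folklore] -/
def betaDenom (A B : ℕ) : ℕ := (A + B + 1).factorial / (A.factorial * B.factorial)

/-- `A! B! ∣ (A+B+1)!`. [folklore] -/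
theorem factorial_mul_factorial_dvd (A B : ℕ) : A.factorial * B.factorial ∣ (A + B + 1).factorial :=
  (Nat.factorial_mul_factorial_dvd_factorial_add A B).trans (Nat.factorial_dvd_factorial (by omega))

/-- `P(1) = 1/N`: the Beta value at integer exponents is the RECIPROCAL OF AN INTEGER. [folklore] -/
theorem aeval_one_antideriv_kerPoly_eq_inv (A B : ℕ) :
    (aeval (1:ℝ) (antideriv (kerPoly A B)) : ℝ) = ((betaDenom A B : ℕ) : ℝ)⁻¹ := by
  rw [aeval_one_antideriv_kerPoly, betaDenom, Nat.cast_div (factorial_mul_factorial_dvd A B)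
    (by positivity), inv_div]
  push_cast
  ring

/-- `N ≠ 0`. [folklore] -/
theorem betaDenom_pos (A B : ℕ) : 0 < betaDenom A B :=
  Nat.div_pos (Nat.le_of_dvd (Nat.factorial_pos _) (factorial_mul_factorial_dvd A B)) (by positivity)

variable {n : ℕ}

/-- **`[[0,1] × σ, p(t) · f]`** (slab coordinate `t` LAST): the band of the Newton–Leibniz move,
for a `ℚ`-polynomial kernel `p`. [folklore] -/
def polySlab (r : IntegralRep n) (p : ℚ[X]) : IntegralRep (n + 1) where
  domain := r.slabDomain 0
  integrand := fun z => (aeval (z (Fin.last n)) p : ℝ) * r.integrand (Fin.init z)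
  isSemialgebraic_domain := r.isSemialgebraic_slabDomain 0
  isSemialgebraicFunOn_integrand := by
    refine IsSemialgebraicFunOn.mul_holds ?_ (r.slab 0).isSemialgebraicFunOn_integrand
    refine (isSemialgebraicFunOn_aeval (r.isSemialgebraic_slabDomain 0)
      (Polynomial.aeval (MvPolynomial.X (Fin.last n) : MvPolynomial (Fin (n + 1)) ℚ) p)).congr
      fun z _ => ?_
    show MvPolynomial.aeval z (Polynomial.aeval (MvPolynomial.X (Fin.last n)) p) = _
    rw [← Polynomial.aeval_algHom_apply, MvPolynomial.aeval_X]
  integrableOn := by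
    obtain ⟨C, hC⟩ := (isCompact_Icc (a := (0:ℝ)) (b := 1)).exists_bound_of_continuousOn
      (Polynomial.continuous_aeval p).continuousOn
    refine Integrable.bdd_mul (c := C) (r.integrableOn_slabDomain 0) ?_ ?_
    · exact ((Polynomial.continuous_aeval p).comp (continuous_apply (Fin.last n))).aestronglyMeasurable
    · refine ae_restrict_of_forall_mem
        (Literature.ModelTheory.ExponentialFields.IsSemialgebraic.measurableSet_holds
          (r.isSemialgebraic_slabDomain 0)) fun z hz => hC _ ⟨?_, ?_⟩
      · simpa using hz.2.1
      · simpa using hz.2.2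

/-- The domain of `polySlab r p`. [folklore] -/
@[simp] theorem polySlab_domain (r : IntegralRep n) (p : ℚ[X]) : (polySlab r p).domain = r.slabDomain 0 := rfl

/-- The integrand of `polySlab r p`. [folklore] -/
@[simp] theorem polySlab_integrand (r : IntegralRep n) (p : ℚ[X]) :
    (polySlab r p).integrand = fun z => (aeval (z (Fin.last n)) p : ℝ) * r.integrand (Fin.init z) := rfl

/-- The base `[σ, P(1) · f]` of the Newton–Leibniz move, a scaled copy of `r`. [folklore] -/
def scaledBase (r : IntegralRep n) (p : ℚ[X]) : IntegralRep n :=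
  r.constMul (algebraMap ℚ ℝ ((antideriv p).eval 1)) (isAlgebraic_algebraMap _)

/-- **ONE Newton–Leibniz move**: `[[0,1] × σ, p(t) f] − [σ, P(1) f] ∈ newtonLeibnizRel`, primitive
`F(x, t) = P(t) f(x)` with `P = antideriv p`. [cite: KontsevichZagier2001, §1.2 rule (3)] -/
theorem polySlab_sub_scaledBase_mem (r : IntegralRep n) (p : ℚ[X]) :
    of (polySlab r p) - of (scaledBase r p) ∈ newtonLeibnizRel := by
  refine ⟨n, polySlab r p, scaledBase r p, fun _ => ((0:ℕ):ℝ), fun _ => ((0:ℕ):ℝ) + 1,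
    fun z => (aeval (z (Fin.last n)) (antideriv p) : ℝ) * r.integrand (Fin.init z),
    (polySlab r (antideriv p)).isSemialgebraicFunOn_integrand,
    isSemialgebraicFunOn_natCast r.isSemialgebraic_domain 0, ?_, fun _ _ => by simp, rfl, ?_, ?_, ?_,
    rfl⟩
  · exact (isSemialgebraicFunOn_aeval r.isSemialgebraic_domain
      (((0:ℕ) : MvPolynomial (Fin n) ℚ) + 1)).congr fun x _ => by simp
  · intro x _
    simp only [Fin.snoc_last, Fin.init_snoc]
    exact ((Polynomial.continuous_aeval _).mul continuous_const).continuousOn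
  · intro x _ t _
    simp only [polySlab_integrand, Fin.snoc_last, Fin.init_snoc]
    have h := (Polynomial.hasDerivAt_aeval (antideriv p) t).mul_const (r.integrand x)
    rwa [derivative_antideriv] at h
  · intro x _
    simp only [scaledBase, IntegralRep.integrand_constMul, Fin.snoc_last, Fin.init_snoc, Nat.cast_zero,
      zero_add, aeval_zero_antideriv, zero_mul, sub_zero]
    congr 1
    have h := Polynomial.aeval_algebraMap_apply_eq_algebraMap_eval (A := ℝ) (1:ℚ) (antideriv p)
    rw [map_one] at h
    exact h.symm

/-- `polySlab` with the slab coordinate FIRST (reindexed along `finAddFlip`). [folklore] -/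
def polySlabFirst (r : IntegralRep n) (p : ℚ[X]) : IntegralRep (1 + n) := (polySlab r p).reindex finAddFlip

/-- The domain of `polySlabFirst r p`. [folklore] -/
theorem polySlabFirst_domain (r : IntegralRep n) (p : ℚ[X]) :
    (polySlabFirst r p).domain = {w | (fun j => w (Fin.natAdd 1 j)) ∈ r.domain ∧
      0 ≤ w (Fin.castAdd n 0) ∧ w (Fin.castAdd n 0) ≤ 1} := by
  ext w
  simp only [polySlabFirst, IntegralRep.reindex_domain, polySlab_domain, IntegralRep.slabDomain,
    mem_setOf_eq, init_comp_finAddFlip, finAddFlip_last, Nat.cast_zero, zero_add]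

/-- The integrand of `polySlabFirst r p` is `p(head) · f(tail)`. [folklore] -/
theorem polySlabFirst_integrand (r : IntegralRep n) (p : ℚ[X]) (w : Fin (1 + n) → ℝ) :
    (polySlabFirst r p).integrand w =
      (aeval (w (Fin.castAdd n 0)) p : ℝ) * r.integrand (fun j => w (Fin.natAdd 1 j)) := by
  simp only [polySlabFirst, IntegralRep.reindex_integrand, polySlab_integrand, init_comp_finAddFlip,
    finAddFlip_last]

/-- **A representation pinned with a polynomial kernel is equivalent to its band** (one
coordinate rotation, rule 2, and a null boundary). [folklore] -/
theorem equivalent_polySlab_of_isPinned {p : ℚ[X]} {r : IntegralRep n} {q : IntegralRep (1 + n)}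
    (hq : IsPinned (fun t => (aeval t p : ℝ)) r q) : Equivalent q (polySlab r p) := by
  obtain ⟨hd, hi⟩ := hq
  have hE : IsSemialgebraic ℚ (pinDomain r.domain) := hd ▸ q.isSemialgebraic_domain
  have hEsub : pinDomain r.domain ⊆ (polySlabFirst r p).domain := by
    intro w hw
    rw [polySlabFirst_domain]
    exact ⟨hw.2, hw.1.1.le, hw.1.2.le⟩
  have hvol : volume ((polySlabFirst r p).domain \ pinDomain r.domain) = 0 := by
    refine measure_mono_null (fun w hw => ?_)
      (measure_union_null (volume_setOf_apply_eq_zero (Fin.castAdd n 0) 0)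
        (volume_setOf_apply_eq_zero (Fin.castAdd n 0) 1))
    rw [polySlabFirst_domain] at hw
    obtain ⟨⟨hσ, h0, h1⟩, hno⟩ := hw
    by_contra hc
    simp only [mem_union, mem_setOf_eq, not_or] at hc
    exact hno ⟨⟨lt_of_le_of_ne h0 (Ne.symm hc.1), lt_of_le_of_ne h1 hc.2⟩, hσ⟩
  have h1 := (polySlabFirst r p).of_sub_of_restrict_mem_relations hE hEsub hvol
  have h2 : of ((polySlabFirst r p).restrict _ hE hEsub) - of q ∈ relations := by
    refine of_sub_of_mem_relations_of_eqOn hd fun w hw => ?_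
    simp only [IntegralRep.integrand_restrict, IntegralRep.domain_restrict] at hw ⊢
    rw [hi (hd ▸ hw), polySlabFirst_integrand]
    simp [pinFun]
  have h3 : of (polySlab r p) - of (polySlabFirst r p) ∈ relations :=
    of_sub_of_reindex_mem_relations (polySlab r p) finAddFlip
  have : of (polySlab r p) - of q = (of (polySlab r p) - of (polySlabFirst r p)) +
      (of (polySlabFirst r p) - of ((polySlabFirst r p).restrict _ hE hEsub)) +
      (of ((polySlabFirst r p).restrict _ hE hEsub) - of q) := by abel
  apply Equivalent.symm
  show of (polySlab r p) - of q ∈ relations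
  rw [this]
  exact relations.add_mem (relations.add_mem h3 h1) h2

/-- **A pinned representation with polynomial kernel is equivalent to the scaled base**
`[σ, P(1) f]`. [folklore] -/
theorem equivalent_scaledBase_of_isPinned {p : ℚ[X]} {r : IntegralRep n} {q : IntegralRep (1 + n)}
    (hq : IsPinned (fun t => (aeval t p : ℝ)) r q) : Equivalent q (scaledBase r p) :=
  (equivalent_polySlab_of_isPinned hq).trans
    (newtonLeibnizRel_subset_relations (polySlab_sub_scaledBase_mem r p))

/-- **`[r] − N • [σ, f/N] ∈ relations`** when `P(1) = 1/N`: integrand additivity only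
(`KZ.IntegralRep.of_constMul_nat_sub_nsmul_mem_relations`), NO division. [folklore] -/
theorem of_sub_nsmul_scaledBase_mem (r : IntegralRep n) (A B : ℕ) :
    of r - betaDenom A B • of (scaledBase r (kerPoly A B)) ∈ relations := by
  have hN : ((betaDenom A B : ℕ) : ℝ) ≠ 0 := by exact_mod_cast (betaDenom_pos A B).ne'
  have h1 := (scaledBase r (kerPoly A B)).of_constMul_nat_sub_nsmul_mem_relations (betaDenom A B)
  have h2 : of r - of ((scaledBase r (kerPoly A B)).constMul ((betaDenom A B : ℕ) : ℝ)
      (isAlgebraic_nat _)) ∈ relations := by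
    refine of_sub_of_mem_relations_of_eqOn rfl fun x _ => ?_
    simp only [scaledBase, IntegralRep.integrand_constMul]
    rw [← Polynomial.aeval_algebraMap_apply_eq_algebraMap_eval, map_one,
      aeval_one_antideriv_kerPoly_eq_inv, ← mul_assoc, mul_inv_cancel₀ hN, one_mul]
  have := relations.add_mem h2 h1
  simpa using this

/-- **`BetaCancellation` HOLDS for all positive integer exponents** (kernel form). [folklore] -/
theorem kernelCancellation_betaKernel_natCast_succ (A B : ℕ) :
    KernelCancellation (betaKernel ((A:ℚ) + 1) ((B:ℚ) + 1)) := by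
  rw [betaKernel_natCast_succ]
  intro n m r r' q q' hq hq' hqq'
  have hs : Equivalent (scaledBase r (kerPoly A B)) (scaledBase r' (kerPoly A B)) :=
    ((equivalent_scaledBase_of_isPinned hq).symm.trans hqq').trans
      (equivalent_scaledBase_of_isPinned hq')
  have h1 := of_sub_nsmul_scaledBase_mem r A B
  have h2 := of_sub_nsmul_scaledBase_mem r' A B
  have h3 : betaDenom A B • (of (scaledBase r (kerPoly A B)) - of (scaledBase r' (kerPoly A B))) ∈
      relations := relations.nsmul_mem hs _
  have : of r - of r' = (of r - betaDenom A B • of (scaledBase r (kerPoly A B))) +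
      betaDenom A B • (of (scaledBase r (kerPoly A B)) - of (scaledBase r' (kerPoly A B))) -
      (of r' - betaDenom A B • of (scaledBase r' (kerPoly A B))) := by
    rw [nsmul_sub]; abel
  show of r - of r' ∈ relations
  rw [this]
  exact relations.sub_mem (relations.add_mem h1 h3) h2

/-- **`BetaCancellation` for positive integers `a, b`**, with the parameters as rationals.
[folklore] -/
theorem kernelCancellation_betaKernel_of_int {a b : ℚ} (ha : ∃ A : ℕ, a = A + 1) (hb : ∃ B : ℕ, b = B + 1) :
    KernelCancellation (betaKernel a b) := by
  obtain ⟨A, rfl⟩ := ha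
  obtain ⟨B, rfl⟩ := hb
  exact kernelCancellation_betaKernel_natCast_succ A B

/-- **`BetaCancellation` for positive INTEGER `a, b`, in the crux's literal shape.** [folklore] -/
theorem betaCancellation_of_int (a b : ℚ) (ha : ∃ A : ℕ, a = A + 1) (hb : ∃ B : ℕ, b = B + 1) :
    ∀ ⦃n m : ℕ⦄ (r : IntegralRep n) (r' : IntegralRep m) (q : IntegralRep (1 + n))
      (q' : IntegralRep (1 + m)),
    q.domain = {z | z (Fin.castAdd n 0) ∈ Set.Ioo (0:ℝ) 1 ∧ (fun j => z (Fin.natAdd 1 j)) ∈ r.domain} →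
    Set.EqOn q.integrand (fun z => (z (Fin.castAdd n 0)) ^ ((a:ℝ) - 1) *
      (1 - z (Fin.castAdd n 0)) ^ ((b:ℝ) - 1) * r.integrand (fun j => z (Fin.natAdd 1 j))) q.domain →
    q'.domain = {z | z (Fin.castAdd m 0) ∈ Set.Ioo (0:ℝ) 1 ∧ (fun j => z (Fin.natAdd 1 j)) ∈ r'.domain} →
    Set.EqOn q'.integrand (fun z => (z (Fin.castAdd m 0)) ^ ((a:ℝ) - 1) *
      (1 - z (Fin.castAdd m 0)) ^ ((b:ℝ) - 1) * r'.integrand (fun j => z (Fin.natAdd 1 j))) q'.domain →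
    Equivalent q q' → Equivalent r r' :=
  fun _ _ r r' q q' hd hi hd' hi' hqq' =>
    kernelCancellation_betaKernel_of_int ha hb r r' q q' ⟨hd, hi⟩ ⟨hd', hi'⟩ hqq'

end IntegerExponents

end Summit.KontsevichZagierPeriods.KontsevichZagierPeriods.BetaCancellationNegative
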